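import Summits.CriticalPhenomena.PercolationContinuityZ3.Theorems.PercNearOneGluingNoHeavyLowerTailKnQuestion8CoefficientwiseCoreClassKernelMixDigonTerms
import Summits.CriticalPhenomena.PercolationContinuityZ3.Theorems.PercNearOneGluingNoHeavyLowerTailKnQuestion8CoefficientwiseCoreClassKernelMixBundleWithUnitThreadIET

/-!
# ★ DIGON REMOVAL: CONJECTURE IET passes from a bundle to the bundle with an extra thread of length 2

Support file (`--supports stmt-CriticalPhenomena-4575`, closed), prover `prim-cplus-coupling` (gen 70).  No definitions, no named facts, no sorries;
standard axioms.  Memo `prim-cplus-coupling/A5-COUPLING-gen70.md` §8; `prim-cplus-coupling/THEOREM-IET-DIGON.md`.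

THEOREM `Coefficientwise.iet_bundle_digon`.  Explicit bundle with `r + 1` threads (the lane's standing format) whose last thread is a digon
`u – m – b` (`L r = 2`); `E'` = the edges of the first `r` threads, `E` = all edges.  IF the IET functional of the `r`-thread bundle `E'` is
nonnegative for every up-closed event and all monotone levels `0 ≤ hᵃ, hᵇ ≤ h`, `0 ≤ kᵃ, kᵇ ≤ k` (hypothesis `hIH`, literally the conclusion of
`iet_bundle_threeThreads` / `iet_bundle_withUnitThread` / … for that bundle), THEN so is the IET functional of `E`:
  `Σ_{ω ∈ 𝒱, b ∈ X∖Y} h(X) k(X) + Σ_{ω ∈ 𝒱, b ∈ Y∖X} (hᵃX − hᵇY)(kᵃX − kᵇY) ≥ 0`   (`X = C_u(ω)`, `Y = C_u(E∖ω)`).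
We assume a spare edge label `ec ∉ E` with ends `{u, b}` (harmless: enlarge the label type), used to realise the chorded comparison bundle.
COROLLARY (with IET(3) `iet_bundle_threeThreads`, gen 59): CONJECTURE IET holds on every bundle `Θ(2, ℓ₁, ℓ₂, ℓ₃)` — the 'first open
chordless case' `Θ(2,3,3,3)` of memos 59–69 — and, iterating, on every bundle with at most three threads of length `≥ 3` and any number of
shorter threads.

PROOF (memo §8).  Slice the colourings by the state of the two digon edges.  State (um red, mb blue): `X = C'_u(ω) ∪ {m}`, `Y = C'_u(E'∖ω) ∪ {m | b ∈ ·}`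
(`DigonSlices.digon_clusters`), and the slice is the IET functional of `E'` for the event `ω ↦ 𝒱(ω ∪ {um})` and the levels `S ↦ f(S ∪ {m})`
(X-side) / `S ↦ f(S ∪ {m})` if `b ∈ S` else `f S` (Y-side) — nonnegative by `hIH`; state (um blue, mb red) symmetrically with all levels
conditional.  The digon-red slice is termwise `≥ 0` (supply terms) and dominates its restriction to the event of the digon-blue slice; that
restriction plus the digon-blue slice is the IET functional of the CHORDED bundle `E' + {ub}` (chord red ↔ digon red, chord blue ↔ digon blue;
`C_u(· ∪ {um, mb}) = C_u(· ∪ {ub}) ∪ {m}`) with conditional levels — nonnegative by `iet_bundle_withUnitThread`.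
[cite: KozmaNitzan2024, Questions 8–9 (§5.5 p. 36) (context); Harris 1960; Kleitman 1966]
-/

namespace Summit.CriticalPhenomena.PercolationContinuityZ3.Theorems

open Finset Literature.Probability.Percolation

namespace Coefficientwise

variable {ι V : Type*}

/-! ### The slices and the theorem -/

open Classical in
/-- Slice (um red, mb blue): nonnegative by the hypothesis for the `r`-thread bundle with shifted/conditional levels. -/
theorem digon_slice_RB (ends : ι → Sym2 V) (r : ℕ) (L : ℕ → ℕ) 
    (w : ℕ → ℕ → V) (e : ℕ → ℕ → ι) (u b : V)
    (hw0 : ∀ t, t < r + 1 → w t 0 = u) (hwL : ∀ t, t < r + 1 → w t (L t) = b)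
    (harc : ∀ t, t < r + 1 → ∀ j, 1 ≤ j → j ≤ L t → ends (e t j) = s(w t (j - 1), w t j))
    (hwinj : ∀ t, t < r + 1 → ∀ i j, i ≤ L t → j ≤ L t → w t i = w t j → i = j)
    (hcross : ∀ t t', t < r + 1 → t' < r + 1 → t ≠ t' → ∀ i j, i ≤ L t → j ≤ L t' → w t i = w t' j → (i = 0 ∧ j = 0) ∨ (i = L t ∧ j = L t'))
    (A : ℕ → Finset ι) (hA : ∀ t, t < r + 1 → ∀ i, i ∈ A t ↔ ∃ j, 1 ≤ j ∧ j ≤ L t ∧ e t j = i)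
    (hAdisj : ∀ t t', t < r + 1 → t' < r + 1 → t ≠ t' → Disjoint (A t) (A t'))
    (E E' : Finset ι) (hEA : ∀ i, i ∈ E ↔ ∃ t, t < r + 1 ∧ i ∈ A t) (hEA' : ∀ i, i ∈ E' ↔ ∃ t, t < r ∧ i ∈ A t)
    (hdig : L r = 2)
    (hIH : ∀ (𝒱' : Finset ι → Prop), (∀ ⦃s t : Finset ι⦄, s ⊆ t → 𝒱' s → 𝒱' t) →
      ∀ (h' k' ha' hb' ka' kb' : Set V → ℝ), Monotone h' → Monotone k' → Monotone ha' → Monotone hb' → Monotone ka' → Monotone kb' →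
      (∀ S, 0 ≤ ha' S) → (∀ S, ha' S ≤ h' S) → (∀ S, 0 ≤ hb' S) → (∀ S, hb' S ≤ h' S) →
      (∀ S, 0 ≤ ka' S) → (∀ S, ka' S ≤ k' S) → (∀ S, 0 ≤ kb' S) → (∀ S, kb' S ≤ k' S) →
      0 ≤ (∑ ω ∈ (E').powerset, if 𝒱' ω ∧ (b ∈ (openCluster (ends '' (↑(ω) : Set ι)) u) ∧ b ∉ (openCluster (ends '' (↑(E' \ ω) : Set ι)) u)) then
        h' (openCluster (ends '' (↑(ω) : Set ι)) u) * k' (openCluster (ends '' (↑(ω) : Set ι)) u) else 0)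
      + ∑ ω ∈ (E').powerset, if 𝒱' ω ∧ (b ∈ (openCluster (ends '' (↑(E' \ ω) : Set ι)) u) ∧ b ∉ (openCluster (ends '' (↑(ω) : Set ι)) u)) then
        (ha' (openCluster (ends '' (↑(ω) : Set ι)) u) - hb' (openCluster (ends '' (↑(E' \ ω) : Set ι)) u)) *
          (ka' (openCluster (ends '' (↑(ω) : Set ι)) u) - kb' (openCluster (ends '' (↑(E' \ ω) : Set ι)) u)) else 0)
    (𝒱 : Finset ι → Prop) (hV : ∀ ⦃s t : Finset ι⦄, s ⊆ t → 𝒱 s → 𝒱 t)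
    (h k ha hb ka kb : Set V → ℝ) (mh : Monotone h) (mk : Monotone k)
    (mha : Monotone ha) (mhb : Monotone hb) (mka : Monotone ka) (mkb : Monotone kb)
    (ha0 : ∀ S, 0 ≤ ha S) (hah : ∀ S, ha S ≤ h S) (hb0 : ∀ S, 0 ≤ hb S) (hbh : ∀ S, hb S ≤ h S)
    (ka0 : ∀ S, 0 ≤ ka S) (kak : ∀ S, ka S ≤ k S) (kb0 : ∀ S, 0 ≤ kb S) (kbk : ∀ S, kb S ≤ k S) :
    0 ≤ ∑ ω ∈ E'.powerset, ((if 𝒱 (insert (e r 1) ω) ∧ (b ∈ (openCluster (ends '' (↑(insert (e r 1) ω) : Set ι)) u) ∧ b ∉ (openCluster (ends '' (↑(E \ insert (e r 1) ω) : Set ι)) u)) then h (openCluster (ends '' (↑(insert (e r 1) ω) : Set ι)) u) * k (openCluster (ends '' (↑(insert (e r 1) ω) : Set ι)) u) else 0) +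
          (if 𝒱 (insert (e r 1) ω) ∧ (b ∈ (openCluster (ends '' (↑(E \ insert (e r 1) ω) : Set ι)) u) ∧ b ∉ (openCluster (ends '' (↑(insert (e r 1) ω) : Set ι)) u)) then (ha (openCluster (ends '' (↑(insert (e r 1) ω) : Set ι)) u) - hb (openCluster (ends '' (↑(E \ insert (e r 1) ω) : Set ι)) u)) * (ka (openCluster (ends '' (↑(insert (e r 1) ω) : Set ι)) u) - kb (openCluster (ends '' (↑(E \ insert (e r 1) ω) : Set ι)) u)) else 0)) := by
  obtain ⟨he1, he2⟩ := DigonSlices.digon_ends ends r L w e u b hw0 hwL harc hdig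
  obtain ⟨hmu, hmb, hub⟩ := DigonSlices.digon_vertex_ne r L w u b hw0 hwL hwinj hdig
  obtain ⟨hne12, he1E, he2E, hEeq⟩ := DigonSlices.digon_edges ends r L w e u b hw0 hwL harc hwinj A hA hAdisj E E' hEA hEA' hdig
  have hbm : b ≠ w r 1 := fun h' => hmb h'.symm
  have he1' : e r 1 ∉ insert (e r 2) E' := by
    rw [Finset.mem_insert, not_or]; exact ⟨hne12, he1E⟩
  have hcl := fun (ω : Finset ι) (hω : ω ⊆ E') =>
    DigonSlices.digon_clusters ends r L w e u b hw0 hwL harc hwinj hcross A hA E' hEA' hdig ω hω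
  have hc1 : ∀ ω, ω ⊆ E' → E \ insert (e r 1) ω = insert (e r 2) (E' \ ω) := by
    intro ω hω
    rw [hEeq, digon_insert_sdiff_insert _ _ _ he1', digon_insert_sdiff _ _ _ (fun h' => he2E (hω h'))]
  have H := hIH (fun ω => 𝒱 (insert (e r 1) ω)) (fun s t hst hs => hV (Finset.insert_subset_insert _ hst) hs)
    (fun S => h (insert (w r 1) S)) (fun S => k (insert (w r 1) S)) (fun S => ha (insert (w r 1) S))
    (fun S => if b ∈ S then hb (insert (w r 1) S) else hb S) (fun S => ka (insert (w r 1) S))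
    (fun S => if b ∈ S then kb (insert (w r 1) S) else kb S)
    (digon_mono_shift mh _) (digon_mono_shift mk _) (digon_mono_shift mha _) (digon_mono_cond mhb _ _)
    (digon_mono_shift mka _) (digon_mono_cond mkb _ _)
    (fun S => ha0 _) (fun S => hah _) (fun S => digon_cond_nonneg hb0 _ _ S) (fun S => digon_cond_le_shift mh hbh _ _ S)
    (fun S => ka0 _) (fun S => kak _) (fun S => digon_cond_nonneg kb0 _ _ S) (fun S => digon_cond_le_shift mk kbk _ _ S)
  rw [← Finset.sum_add_distrib] at H
  refine le_of_le_of_eq H (Finset.sum_congr rfl fun ω hω => ?_)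
  have hω : ω ⊆ E' := Finset.mem_powerset.mp hω
  have hY1 : (openCluster (ends '' (↑(E \ insert (e r 1) ω) : Set ι)) u) = (openCluster (ends '' (↑(E' \ ω) : Set ι)) u) ∪ {v | v = w r 1 ∧ b ∈ (openCluster (ends '' (↑(E' \ ω) : Set ι)) u)} := by
    rw [hc1 ω hω]; exact (hcl (E' \ ω) Finset.sdiff_subset).2.1
  exact (digon_term_RB (𝒱 (insert (e r 1) ω)) (𝒱 (insert (e r 1) ω)) Iff.rfl (openCluster (ends '' (↑(insert (e r 1) ω) : Set ι)) u) (openCluster (ends '' (↑(E \ insert (e r 1) ω) : Set ι)) u)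
    (openCluster (ends '' (↑(ω) : Set ι)) u) (openCluster (ends '' (↑(E' \ ω) : Set ι)) u) (w r 1) b hbm (hcl ω hω).1 hY1 h k ha hb ka kb).symm

open Classical in
/-- Slice (um blue, mb red): nonnegative by the hypothesis for the `r`-thread bundle with conditional levels. -/
theorem digon_slice_BR (ends : ι → Sym2 V) (r : ℕ) (L : ℕ → ℕ) 
    (w : ℕ → ℕ → V) (e : ℕ → ℕ → ι) (u b : V)
    (hw0 : ∀ t, t < r + 1 → w t 0 = u) (hwL : ∀ t, t < r + 1 → w t (L t) = b)
    (harc : ∀ t, t < r + 1 → ∀ j, 1 ≤ j → j ≤ L t → ends (e t j) = s(w t (j - 1), w t j))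
    (hwinj : ∀ t, t < r + 1 → ∀ i j, i ≤ L t → j ≤ L t → w t i = w t j → i = j)
    (hcross : ∀ t t', t < r + 1 → t' < r + 1 → t ≠ t' → ∀ i j, i ≤ L t → j ≤ L t' → w t i = w t' j → (i = 0 ∧ j = 0) ∨ (i = L t ∧ j = L t'))
    (A : ℕ → Finset ι) (hA : ∀ t, t < r + 1 → ∀ i, i ∈ A t ↔ ∃ j, 1 ≤ j ∧ j ≤ L t ∧ e t j = i)
    (hAdisj : ∀ t t', t < r + 1 → t' < r + 1 → t ≠ t' → Disjoint (A t) (A t'))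
    (E E' : Finset ι) (hEA : ∀ i, i ∈ E ↔ ∃ t, t < r + 1 ∧ i ∈ A t) (hEA' : ∀ i, i ∈ E' ↔ ∃ t, t < r ∧ i ∈ A t)
    (hdig : L r = 2)
    (hIH : ∀ (𝒱' : Finset ι → Prop), (∀ ⦃s t : Finset ι⦄, s ⊆ t → 𝒱' s → 𝒱' t) →
      ∀ (h' k' ha' hb' ka' kb' : Set V → ℝ), Monotone h' → Monotone k' → Monotone ha' → Monotone hb' → Monotone ka' → Monotone kb' →
      (∀ S, 0 ≤ ha' S) → (∀ S, ha' S ≤ h' S) → (∀ S, 0 ≤ hb' S) → (∀ S, hb' S ≤ h' S) →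
      (∀ S, 0 ≤ ka' S) → (∀ S, ka' S ≤ k' S) → (∀ S, 0 ≤ kb' S) → (∀ S, kb' S ≤ k' S) →
      0 ≤ (∑ ω ∈ (E').powerset, if 𝒱' ω ∧ (b ∈ (openCluster (ends '' (↑(ω) : Set ι)) u) ∧ b ∉ (openCluster (ends '' (↑(E' \ ω) : Set ι)) u)) then
        h' (openCluster (ends '' (↑(ω) : Set ι)) u) * k' (openCluster (ends '' (↑(ω) : Set ι)) u) else 0)
      + ∑ ω ∈ (E').powerset, if 𝒱' ω ∧ (b ∈ (openCluster (ends '' (↑(E' \ ω) : Set ι)) u) ∧ b ∉ (openCluster (ends '' (↑(ω) : Set ι)) u)) then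
        (ha' (openCluster (ends '' (↑(ω) : Set ι)) u) - hb' (openCluster (ends '' (↑(E' \ ω) : Set ι)) u)) *
          (ka' (openCluster (ends '' (↑(ω) : Set ι)) u) - kb' (openCluster (ends '' (↑(E' \ ω) : Set ι)) u)) else 0)
    (𝒱 : Finset ι → Prop) (hV : ∀ ⦃s t : Finset ι⦄, s ⊆ t → 𝒱 s → 𝒱 t)
    (h k ha hb ka kb : Set V → ℝ) (mh : Monotone h) (mk : Monotone k)
    (mha : Monotone ha) (mhb : Monotone hb) (mka : Monotone ka) (mkb : Monotone kb)
    (ha0 : ∀ S, 0 ≤ ha S) (hah : ∀ S, ha S ≤ h S) (hb0 : ∀ S, 0 ≤ hb S) (hbh : ∀ S, hb S ≤ h S)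
    (ka0 : ∀ S, 0 ≤ ka S) (kak : ∀ S, ka S ≤ k S) (kb0 : ∀ S, 0 ≤ kb S) (kbk : ∀ S, kb S ≤ k S) :
    0 ≤ ∑ ω ∈ E'.powerset, ((if 𝒱 (insert (e r 2) ω) ∧ (b ∈ (openCluster (ends '' (↑(insert (e r 2) ω) : Set ι)) u) ∧ b ∉ (openCluster (ends '' (↑(E \ insert (e r 2) ω) : Set ι)) u)) then h (openCluster (ends '' (↑(insert (e r 2) ω) : Set ι)) u) * k (openCluster (ends '' (↑(insert (e r 2) ω) : Set ι)) u) else 0) +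
          (if 𝒱 (insert (e r 2) ω) ∧ (b ∈ (openCluster (ends '' (↑(E \ insert (e r 2) ω) : Set ι)) u) ∧ b ∉ (openCluster (ends '' (↑(insert (e r 2) ω) : Set ι)) u)) then (ha (openCluster (ends '' (↑(insert (e r 2) ω) : Set ι)) u) - hb (openCluster (ends '' (↑(E \ insert (e r 2) ω) : Set ι)) u)) * (ka (openCluster (ends '' (↑(insert (e r 2) ω) : Set ι)) u) - kb (openCluster (ends '' (↑(E \ insert (e r 2) ω) : Set ι)) u)) else 0)) := by
  obtain ⟨he1, he2⟩ := DigonSlices.digon_ends ends r L w e u b hw0 hwL harc hdig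
  obtain ⟨hmu, hmb, hub⟩ := DigonSlices.digon_vertex_ne r L w u b hw0 hwL hwinj hdig
  obtain ⟨hne12, he1E, he2E, hEeq⟩ := DigonSlices.digon_edges ends r L w e u b hw0 hwL harc hwinj A hA hAdisj E E' hEA hEA' hdig
  have hbm : b ≠ w r 1 := fun h' => hmb h'.symm
  have he1' : e r 1 ∉ insert (e r 2) E' := by
    rw [Finset.mem_insert, not_or]; exact ⟨hne12, he1E⟩
  have hcl := fun (ω : Finset ι) (hω : ω ⊆ E') =>
    DigonSlices.digon_clusters ends r L w e u b hw0 hwL harc hwinj hcross A hA E' hEA' hdig ω hω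
  have hc2 : ∀ ω, ω ⊆ E' → E \ insert (e r 2) ω = insert (e r 1) (E' \ ω) := by
    intro ω hω
    rw [hEeq, Finset.insert_comm, digon_insert_sdiff_insert _ _ _ (by rw [Finset.mem_insert, not_or]; exact ⟨hne12.symm, he2E⟩),
      digon_insert_sdiff _ _ _ (fun h' => he1E (hω h'))]
  have H := hIH (fun ω => 𝒱 (insert (e r 2) ω)) (fun s t hst hs => hV (Finset.insert_subset_insert _ hst) hs)
    (fun S => if b ∈ S then h (insert (w r 1) S) else h S) (fun S => if b ∈ S then k (insert (w r 1) S) else k S)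
    (fun S => if b ∈ S then ha (insert (w r 1) S) else ha S) (fun S => if b ∈ S then hb (insert (w r 1) S) else hb S)
    (fun S => if b ∈ S then ka (insert (w r 1) S) else ka S) (fun S => if b ∈ S then kb (insert (w r 1) S) else kb S)
    (digon_mono_cond mh _ _) (digon_mono_cond mk _ _) (digon_mono_cond mha _ _) (digon_mono_cond mhb _ _)
    (digon_mono_cond mka _ _) (digon_mono_cond mkb _ _)
    (fun S => digon_cond_nonneg ha0 _ _ S) (fun S => digon_cond_le_cond hah _ _ S)
    (fun S => digon_cond_nonneg hb0 _ _ S) (fun S => digon_cond_le_cond hbh _ _ S)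
    (fun S => digon_cond_nonneg ka0 _ _ S) (fun S => digon_cond_le_cond kak _ _ S)
    (fun S => digon_cond_nonneg kb0 _ _ S) (fun S => digon_cond_le_cond kbk _ _ S)
  rw [← Finset.sum_add_distrib] at H
  refine le_of_le_of_eq H (Finset.sum_congr rfl fun ω hω => ?_)
  have hω : ω ⊆ E' := Finset.mem_powerset.mp hω
  have hY1 : (openCluster (ends '' (↑(E \ insert (e r 2) ω) : Set ι)) u) = insert (w r 1) (openCluster (ends '' (↑(E' \ ω) : Set ι)) u) := by
    rw [hc2 ω hω]; exact (hcl (E' \ ω) Finset.sdiff_subset).1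
  exact (digon_term_BR (𝒱 (insert (e r 2) ω)) (𝒱 (insert (e r 2) ω)) Iff.rfl (openCluster (ends '' (↑(insert (e r 2) ω) : Set ι)) u) (openCluster (ends '' (↑(E \ insert (e r 2) ω) : Set ι)) u)
    (openCluster (ends '' (↑(ω) : Set ι)) u) (openCluster (ends '' (↑(E' \ ω) : Set ι)) u) (w r 1) b hbm (hcl ω hω).2.1 hY1 h k ha hb ka kb).symm

open Classical in
/-- Slices (digon red) + (digon blue): at least the IET functional of the CHORDED bundle (thread `r` replaced by the chord `ec`) for the
event of the blue slice and conditional levels — nonnegative by `iet_bundle_withUnitThread`. -/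
theorem digon_slice_RRBB (ends : ι → Sym2 V) (r : ℕ) (L : ℕ → ℕ) (hL : ∀ t, t < r + 1 → 1 ≤ L t)
    (w : ℕ → ℕ → V) (e : ℕ → ℕ → ι) (u b : V)
    (hw0 : ∀ t, t < r + 1 → w t 0 = u) (hwL : ∀ t, t < r + 1 → w t (L t) = b)
    (harc : ∀ t, t < r + 1 → ∀ j, 1 ≤ j → j ≤ L t → ends (e t j) = s(w t (j - 1), w t j))
    (hwinj : ∀ t, t < r + 1 → ∀ i j, i ≤ L t → j ≤ L t → w t i = w t j → i = j)
    (hcross : ∀ t t', t < r + 1 → t' < r + 1 → t ≠ t' → ∀ i j, i ≤ L t → j ≤ L t' → w t i = w t' j → (i = 0 ∧ j = 0) ∨ (i = L t ∧ j = L t'))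
    (A : ℕ → Finset ι) (hA : ∀ t, t < r + 1 → ∀ i, i ∈ A t ↔ ∃ j, 1 ≤ j ∧ j ≤ L t ∧ e t j = i)
    (hAdisj : ∀ t t', t < r + 1 → t' < r + 1 → t ≠ t' → Disjoint (A t) (A t'))
    (E E' : Finset ι) (hEA : ∀ i, i ∈ E ↔ ∃ t, t < r + 1 ∧ i ∈ A t) (hEA' : ∀ i, i ∈ E' ↔ ∃ t, t < r ∧ i ∈ A t)
    (hdig : L r = 2) (ec : ι) (hec : ends ec = s(u, b)) (hecE : ec ∉ E)
    (𝒱 : Finset ι → Prop) (hV : ∀ ⦃s t : Finset ι⦄, s ⊆ t → 𝒱 s → 𝒱 t)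
    (h k ha hb ka kb : Set V → ℝ) (mh : Monotone h) (mk : Monotone k)
    (mha : Monotone ha) (mhb : Monotone hb) (mka : Monotone ka) (mkb : Monotone kb)
    (ha0 : ∀ S, 0 ≤ ha S) (hah : ∀ S, ha S ≤ h S) (hb0 : ∀ S, 0 ≤ hb S) (hbh : ∀ S, hb S ≤ h S)
    (ka0 : ∀ S, 0 ≤ ka S) (kak : ∀ S, ka S ≤ k S) (kb0 : ∀ S, 0 ≤ kb S) (kbk : ∀ S, kb S ≤ k S) :
    0 ≤ (∑ ω ∈ E'.powerset, ((if 𝒱 (ω) ∧ (b ∈ (openCluster (ends '' (↑(ω) : Set ι)) u) ∧ b ∉ (openCluster (ends '' (↑(E \ ω) : Set ι)) u)) then h (openCluster (ends '' (↑(ω) : Set ι)) u) * k (openCluster (ends '' (↑(ω) : Set ι)) u) else 0) +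
          (if 𝒱 (ω) ∧ (b ∈ (openCluster (ends '' (↑(E \ ω) : Set ι)) u) ∧ b ∉ (openCluster (ends '' (↑(ω) : Set ι)) u)) then (ha (openCluster (ends '' (↑(ω) : Set ι)) u) - hb (openCluster (ends '' (↑(E \ ω) : Set ι)) u)) * (ka (openCluster (ends '' (↑(ω) : Set ι)) u) - kb (openCluster (ends '' (↑(E \ ω) : Set ι)) u)) else 0))) +
      ∑ ω ∈ E'.powerset, ((if 𝒱 (insert (e r 1) (insert (e r 2) ω)) ∧ (b ∈ (openCluster (ends '' (↑(insert (e r 1) (insert (e r 2) ω)) : Set ι)) u) ∧ b ∉ (openCluster (ends '' (↑(E \ insert (e r 1) (insert (e r 2) ω)) : Set ι)) u)) then h (openCluster (ends '' (↑(insert (e r 1) (insert (e r 2) ω)) : Set ι)) u) * k (openCluster (ends '' (↑(insert (e r 1) (insert (e r 2) ω)) : Set ι)) u) else 0) +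
          (if 𝒱 (insert (e r 1) (insert (e r 2) ω)) ∧ (b ∈ (openCluster (ends '' (↑(E \ insert (e r 1) (insert (e r 2) ω)) : Set ι)) u) ∧ b ∉ (openCluster (ends '' (↑(insert (e r 1) (insert (e r 2) ω)) : Set ι)) u)) then (ha (openCluster (ends '' (↑(insert (e r 1) (insert (e r 2) ω)) : Set ι)) u) - hb (openCluster (ends '' (↑(E \ insert (e r 1) (insert (e r 2) ω)) : Set ι)) u)) * (ka (openCluster (ends '' (↑(insert (e r 1) (insert (e r 2) ω)) : Set ι)) u) - kb (openCluster (ends '' (↑(E \ insert (e r 1) (insert (e r 2) ω)) : Set ι)) u)) else 0)) := by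
  obtain ⟨he1, he2⟩ := DigonSlices.digon_ends ends r L w e u b hw0 hwL harc hdig
  obtain ⟨hmu, hmb, hub⟩ := DigonSlices.digon_vertex_ne r L w u b hw0 hwL hwinj hdig
  obtain ⟨hne12, he1E, he2E, hEeq⟩ := DigonSlices.digon_edges ends r L w e u b hw0 hwL harc hwinj A hA hAdisj E E' hEA hEA' hdig
  have hbm : b ≠ w r 1 := fun h' => hmb h'.symm
  have he1' : e r 1 ∉ insert (e r 2) E' := by
    rw [Finset.mem_insert, not_or]; exact ⟨hne12, he1E⟩
  have hcl := fun (ω : Finset ι) (hω : ω ⊆ E') =>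
    DigonSlices.digon_clusters ends r L w e u b hw0 hwL harc hwinj hcross A hA E' hEA' hdig ω hω
  have hh0 : ∀ S, 0 ≤ h S := fun S => (ha0 S).trans (hah S)
  have hk0 : ∀ S, 0 ≤ k S := fun S => (ka0 S).trans (kak S)
  have hE'E : E' ⊆ E := by
    intro i hi; rw [hEeq]; exact Finset.mem_insert_of_mem (Finset.mem_insert_of_mem hi)
  have hecE' : ec ∉ E' := fun h' => hecE (hE'E h')
  have hbC : ∀ S : Set (Sym2 V), b ∈ openCluster (insert s(u, b) S) u := by
    intro S
    have hadj : (openGraph (insert s(u, b) S)).Adj u b := by rw [openGraph_adj]; exact ⟨Set.mem_insert _ _, hub⟩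
    exact hadj.reachable
  have himc : ∀ ω : Finset ι, (ends '' (↑(insert ec ω) : Set ι)) = insert s(u, b) (ends '' (↑ω : Set ι)) := by
    intro ω; rw [Finset.coe_insert, Set.image_insert_eq, hec]
  have hc0 : ∀ ω, ω ⊆ E' → E \ ω = insert (e r 1) (insert (e r 2) (E' \ ω)) := by
    intro ω hω
    rw [hEeq, digon_insert_sdiff _ _ _ (fun h' => he1E (hω h')), digon_insert_sdiff _ _ _ (fun h' => he2E (hω h'))]
  have hc12 : ∀ ω, ω ⊆ E' → E \ insert (e r 1) (insert (e r 2) ω) = E' \ ω := by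
    intro ω hω
    rw [hEeq, digon_insert_sdiff_insert _ _ _ he1', digon_insert_sdiff_insert _ _ _ he2E]
  have hcc1 : ∀ ω, ω ⊆ E' → insert ec E' \ ω = insert ec (E' \ ω) := by
    intro ω hω; rw [digon_insert_sdiff _ _ _ (fun h' => hecE' (hω h'))]
  have hcc2 : ∀ ω, ω ⊆ E' → insert ec E' \ insert ec ω = E' \ ω := by
    intro ω _; rw [digon_insert_sdiff_insert _ _ _ hecE']
  -- hypotheses of the chorded bundle: thread `r` becomes the unit thread `ec`
  have cL : ∀ t, t < r + 1 → 1 ≤ (fun t => if t = r then 1 else L t) t := by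
    intro t ht; by_cases htr : t = r
    · simp only [htr, if_true, le_refl]
    · simp only [htr, if_false]; exact hL t ht
  have cw0 : ∀ t, t < r + 1 → (fun t j => if t = r then (if j = 0 then u else b) else w t j) t 0 = u := by
    intro t ht; by_cases htr : t = r
    · simp only [htr, if_true]
    · simp only [htr, if_false]; exact hw0 t ht
  have cwL : ∀ t, t < r + 1 → (fun t j => if t = r then (if j = 0 then u else b) else w t j) t ((fun t => if t = r then 1 else L t) t) = b := by
    intro t ht; by_cases htr : t = r
    · simp only [htr, if_true, one_ne_zero, if_false]
    · simp only [htr, if_false]; exact hwL t ht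
  have carc : ∀ t, t < r + 1 → ∀ j, 1 ≤ j → j ≤ (fun t => if t = r then 1 else L t) t →
      ends ((fun t j => if t = r then ec else e t j) t j) =
        s((fun t j => if t = r then (if j = 0 then u else b) else w t j) t (j - 1), (fun t j => if t = r then (if j = 0 then u else b) else w t j) t j) := by
    intro t ht j hj1 hjL
    by_cases htr : t = r
    · subst htr; simp only [if_true] at hjL ⊢
      have hj : j = 1 := le_antisymm hjL hj1
      subst hj; simp only [Nat.sub_self, if_true, one_ne_zero, if_false]; exact hec
    · simp only [htr, if_false] at hjL ⊢; exact harc t ht j hj1 hjL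
  have cwinj : ∀ t, t < r + 1 → ∀ i j, i ≤ (fun t => if t = r then 1 else L t) t → j ≤ (fun t => if t = r then 1 else L t) t →
      (fun t j => if t = r then (if j = 0 then u else b) else w t j) t i = (fun t j => if t = r then (if j = 0 then u else b) else w t j) t j → i = j := by
    intro t ht i j hi hj hij
    by_cases htr : t = r
    · subst htr; simp only [if_true] at hi hj hij
      have hi' : i = 0 ∨ i = 1 := by omega
      have hj' : j = 0 ∨ j = 1 := by omega
      rcases hi' with rfl | rfl <;> rcases hj' with rfl | rfl
      · rfl
      · simp only [if_true, one_ne_zero, if_false] at hij; exact absurd hij hub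
      · simp only [if_true, one_ne_zero, if_false] at hij; exact absurd hij.symm hub
      · rfl
    · simp only [htr, if_false] at hi hj hij; exact hwinj t ht i j hi hj hij
  have ccross : ∀ t t', t < r + 1 → t' < r + 1 → t ≠ t' → ∀ i j, i ≤ (fun t => if t = r then 1 else L t) t → j ≤ (fun t => if t = r then 1 else L t) t' →
      (fun t j => if t = r then (if j = 0 then u else b) else w t j) t i = (fun t j => if t = r then (if j = 0 then u else b) else w t j) t' j →
        (i = 0 ∧ j = 0) ∨ (i = (fun t => if t = r then 1 else L t) t ∧ j = (fun t => if t = r then 1 else L t) t') := by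
    intro t t' ht ht' htt' i j hi hj hij
    by_cases htr : t = r
    · subst htr
      have ht'r : t' ≠ t := fun h' => htt' h'.symm
      simp only [if_true, ht'r, if_false] at hi hj hij ⊢
      have hi' : i = 0 ∨ i = 1 := by omega
      rcases hi' with rfl | rfl
      · simp only [if_true] at hij
        exact Or.inl ⟨rfl, hwinj t' ht' j 0 hj (Nat.zero_le _) (hij.symm.trans (hw0 t' ht').symm)⟩
      · simp only [one_ne_zero, if_false] at hij
        exact Or.inr ⟨rfl, hwinj t' ht' j (L t') hj le_rfl (hij.symm.trans (hwL t' ht').symm)⟩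
    · by_cases ht'r : t' = r
      · subst ht'r
        simp only [htr, if_true, if_false] at hi hj hij ⊢
        have hj' : j = 0 ∨ j = 1 := by omega
        rcases hj' with rfl | rfl
        · simp only [if_true] at hij
          exact Or.inl ⟨hwinj t ht i 0 hi (Nat.zero_le _) (hij.trans (hw0 t ht).symm), rfl⟩
        · simp only [one_ne_zero, if_false] at hij
          exact Or.inr ⟨hwinj t ht i (L t) hi le_rfl (hij.trans (hwL t ht).symm), rfl⟩
      · simp only [htr, ht'r, if_false] at hi hj hij ⊢
        exact hcross t t' ht ht' htt' i j hi hj hij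
  have hsub : ∀ t₀, t₀ < r + 1 → ec ∉ A t₀ := fun t₀ h₀ hm => hecE ((hEA ec).mpr ⟨t₀, h₀, hm⟩)
  have cA : ∀ t, t < r + 1 → ∀ i, i ∈ (fun t => if t = r then ({ec} : Finset ι) else A t) t ↔
      ∃ j, 1 ≤ j ∧ j ≤ (fun t => if t = r then 1 else L t) t ∧ (fun t j => if t = r then ec else e t j) t j = i := by
    intro t ht i
    by_cases htr : t = r
    · subst htr; simp only [if_true, Finset.mem_singleton]
      constructor
      · intro hi; exact ⟨1, le_rfl, le_rfl, hi.symm⟩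
      · rintro ⟨j, _, _, hji⟩; exact hji.symm
    · simp only [htr, if_false]; exact hA t ht i
  have cAdisj : ∀ t t', t < r + 1 → t' < r + 1 → t ≠ t' →
      Disjoint ((fun t => if t = r then ({ec} : Finset ι) else A t) t) ((fun t => if t = r then ({ec} : Finset ι) else A t) t') := by
    intro t t' ht ht' htt'
    by_cases htr : t = r
    · subst htr
      have ht'r : t' ≠ t := fun h' => htt' h'.symm
      simp only [if_true, ht'r, if_false, Finset.disjoint_singleton_left]
      exact hsub t' ht'
    · by_cases ht'r : t' = r
      · subst ht'r; simp only [htr, if_true, if_false, Finset.disjoint_singleton_right]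
        exact hsub t ht
      · simp only [htr, ht'r, if_false]; exact hAdisj t t' ht ht' htt'
  have cEA : ∀ i, i ∈ insert ec E' ↔ ∃ t, t < r + 1 ∧ i ∈ (fun t => if t = r then ({ec} : Finset ι) else A t) t := by
    intro i
    rw [Finset.mem_insert, hEA' i]
    constructor
    · rintro (hi | ⟨t, ht, hit⟩)
      · exact ⟨r, Nat.lt_succ_self r, by simp only [if_true, Finset.mem_singleton]; exact hi⟩
      · have htr : t ≠ r := by omega
        exact ⟨t, by omega, by simp only [htr, if_false]; exact hit⟩
    · rintro ⟨t, ht, hit⟩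
      by_cases htr : t = r
      · subst htr; simp only [if_true, Finset.mem_singleton] at hit; exact Or.inl hit
      · simp only [htr, if_false] at hit; exact Or.inr ⟨t, by omega, hit⟩
  have HC := iet_bundle_withUnitThread ends (r + 1) (fun t => if t = r then 1 else L t) cL
    (fun t j => if t = r then (if j = 0 then u else b) else w t j) (fun t j => if t = r then ec else e t j) u b
    cw0 cwL carc cwinj ccross (fun t => if t = r then ({ec} : Finset ι) else A t) cA cAdisj (insert ec E') cEA
    r (Nat.lt_succ_self r) (by simp only [if_true])
    (fun ω' => 𝒱 (ω'.erase ec)) (fun s t hst hs => hV (Finset.erase_subset_erase ec hst) hs)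
    (fun S => if b ∈ S then h (insert (w r 1) S) else h S) (fun S => if b ∈ S then k (insert (w r 1) S) else k S)
    (fun S => if b ∈ S then ha (insert (w r 1) S) else ha S) (fun S => if b ∈ S then hb (insert (w r 1) S) else hb S)
    (fun S => if b ∈ S then ka (insert (w r 1) S) else ka S) (fun S => if b ∈ S then kb (insert (w r 1) S) else kb S)
    (digon_mono_cond mh _ _) (digon_mono_cond mk _ _) (digon_mono_cond mha _ _) (digon_mono_cond mhb _ _)
    (digon_mono_cond mka _ _) (digon_mono_cond mkb _ _)
    (fun S => digon_cond_nonneg ha0 _ _ S) (fun S => digon_cond_le_cond hah _ _ S)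
    (fun S => digon_cond_nonneg hb0 _ _ S) (fun S => digon_cond_le_cond hbh _ _ S)
    (fun S => digon_cond_nonneg ka0 _ _ S) (fun S => digon_cond_le_cond kak _ _ S)
    (fun S => digon_cond_nonneg kb0 _ _ S) (fun S => digon_cond_le_cond kbk _ _ S)
  rw [← Finset.sum_add_distrib, Finset.sum_powerset_insert hecE', ← Finset.sum_add_distrib] at HC
  rw [← Finset.sum_add_distrib]
  refine le_trans HC (Finset.sum_le_sum fun ω hω => ?_)
  have hω : ω ⊆ E' := Finset.mem_powerset.mp hω
  have hecω : ec ∉ ω := fun h' => hecE' (hω h')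
  have hPB : 𝒱 (ω.erase ec) ↔ 𝒱 ω := by rw [Finset.erase_eq_of_notMem hecω]
  have hPR : 𝒱 ((insert ec ω).erase ec) → 𝒱 (insert (e r 1) (insert (e r 2) ω)) := by
    rw [Finset.erase_insert hecω]
    exact fun h' => hV (fun i hi => Finset.mem_insert_of_mem (Finset.mem_insert_of_mem hi)) h'
  have hY1 : (openCluster (ends '' (↑(E \ ω) : Set ι)) u) = insert (w r 1) (openCluster (ends '' (↑(insert ec E' \ ω) : Set ι)) u) := by
    rw [hc0 ω hω, hcc1 ω hω, himc]; exact (hcl (E' \ ω) Finset.sdiff_subset).2.2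
  have hbY : b ∈ (openCluster (ends '' (↑(insert ec E' \ ω) : Set ι)) u) := by rw [hcc1 ω hω, himc]; exact hbC _
  have eBB := digon_term_BB (𝒱 (ω.erase ec)) (𝒱 ω) hPB (openCluster (ends '' (↑(ω) : Set ι)) u) (openCluster (ends '' (↑(insert ec E' \ ω) : Set ι)) u)
    (openCluster (ends '' (↑(E \ ω) : Set ι)) u) (w r 1) b hY1 hbY h k ha hb ka kb
  have hX1 : (openCluster (ends '' (↑(insert (e r 1) (insert (e r 2) ω)) : Set ι)) u) = insert (w r 1) (openCluster (ends '' (↑(insert ec ω) : Set ι)) u) := by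
    rw [himc]; exact (hcl ω hω).2.2
  have hY1' : (openCluster (ends '' (↑(E \ insert (e r 1) (insert (e r 2) ω)) : Set ι)) u) = (openCluster (ends '' (↑(insert ec E' \ insert ec ω) : Set ι)) u) := by
    rw [hc12 ω hω, hcc2 ω hω]
  have hbX : b ∈ (openCluster (ends '' (↑(insert ec ω) : Set ι)) u) := by rw [himc]; exact hbC _
  have eRR := digon_term_RR_ge (𝒱 ((insert ec ω).erase ec)) (𝒱 (insert (e r 1) (insert (e r 2) ω))) hPR
    (openCluster (ends '' (↑(insert ec ω) : Set ι)) u) (openCluster (ends '' (↑(insert ec E' \ insert ec ω) : Set ι)) u) (openCluster (ends '' (↑(insert (e r 1) (insert (e r 2) ω)) : Set ι)) u)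
    (openCluster (ends '' (↑(E \ insert (e r 1) (insert (e r 2) ω)) : Set ι)) u) (w r 1) b hX1 hY1' hbX h k ha hb ka kb hh0 hk0
  linarith [eBB, eRR]

open Classical in
/-- **DIGON REMOVAL.**  Module docstring.  `hIH` is the IET conclusion for the bundle of the first `r` threads (edge set `E'`);
`ec ∉ E` is a spare edge label with ends `{u, b}` (the chord of the comparison bundle; enlarge the label type if necessary).
[cite: KozmaNitzan2024, Questions 8–9 (§5.5 p. 36) (context); Harris 1960; Kleitman 1966] -/
theorem iet_bundle_digon (ends : ι → Sym2 V) (r : ℕ) (L : ℕ → ℕ) (hL : ∀ t, t < r + 1 → 1 ≤ L t)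
    (w : ℕ → ℕ → V) (e : ℕ → ℕ → ι) (u b : V)
    (hw0 : ∀ t, t < r + 1 → w t 0 = u) (hwL : ∀ t, t < r + 1 → w t (L t) = b)
    (harc : ∀ t, t < r + 1 → ∀ j, 1 ≤ j → j ≤ L t → ends (e t j) = s(w t (j - 1), w t j))
    (hwinj : ∀ t, t < r + 1 → ∀ i j, i ≤ L t → j ≤ L t → w t i = w t j → i = j)
    (hcross : ∀ t t', t < r + 1 → t' < r + 1 → t ≠ t' → ∀ i j, i ≤ L t → j ≤ L t' → w t i = w t' j → (i = 0 ∧ j = 0) ∨ (i = L t ∧ j = L t'))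
    (A : ℕ → Finset ι) (hA : ∀ t, t < r + 1 → ∀ i, i ∈ A t ↔ ∃ j, 1 ≤ j ∧ j ≤ L t ∧ e t j = i)
    (hAdisj : ∀ t t', t < r + 1 → t' < r + 1 → t ≠ t' → Disjoint (A t) (A t'))
    (E E' : Finset ι) (hEA : ∀ i, i ∈ E ↔ ∃ t, t < r + 1 ∧ i ∈ A t) (hEA' : ∀ i, i ∈ E' ↔ ∃ t, t < r ∧ i ∈ A t)
    (hdig : L r = 2) (ec : ι) (hec : ends ec = s(u, b)) (hecE : ec ∉ E)
    (hIH : ∀ (𝒱' : Finset ι → Prop), (∀ ⦃s t : Finset ι⦄, s ⊆ t → 𝒱' s → 𝒱' t) →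
      ∀ (h' k' ha' hb' ka' kb' : Set V → ℝ), Monotone h' → Monotone k' → Monotone ha' → Monotone hb' → Monotone ka' → Monotone kb' →
      (∀ S, 0 ≤ ha' S) → (∀ S, ha' S ≤ h' S) → (∀ S, 0 ≤ hb' S) → (∀ S, hb' S ≤ h' S) →
      (∀ S, 0 ≤ ka' S) → (∀ S, ka' S ≤ k' S) → (∀ S, 0 ≤ kb' S) → (∀ S, kb' S ≤ k' S) →
      0 ≤ (∑ ω ∈ (E').powerset, if 𝒱' ω ∧ (b ∈ (openCluster (ends '' (↑(ω) : Set ι)) u) ∧ b ∉ (openCluster (ends '' (↑(E' \ ω) : Set ι)) u)) then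
        h' (openCluster (ends '' (↑(ω) : Set ι)) u) * k' (openCluster (ends '' (↑(ω) : Set ι)) u) else 0)
      + ∑ ω ∈ (E').powerset, if 𝒱' ω ∧ (b ∈ (openCluster (ends '' (↑(E' \ ω) : Set ι)) u) ∧ b ∉ (openCluster (ends '' (↑(ω) : Set ι)) u)) then
        (ha' (openCluster (ends '' (↑(ω) : Set ι)) u) - hb' (openCluster (ends '' (↑(E' \ ω) : Set ι)) u)) *
          (ka' (openCluster (ends '' (↑(ω) : Set ι)) u) - kb' (openCluster (ends '' (↑(E' \ ω) : Set ι)) u)) else 0)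
    (𝒱 : Finset ι → Prop) (hV : ∀ ⦃s t : Finset ι⦄, s ⊆ t → 𝒱 s → 𝒱 t)
    (h k ha hb ka kb : Set V → ℝ) (mh : Monotone h) (mk : Monotone k)
    (mha : Monotone ha) (mhb : Monotone hb) (mka : Monotone ka) (mkb : Monotone kb)
    (ha0 : ∀ S, 0 ≤ ha S) (hah : ∀ S, ha S ≤ h S) (hb0 : ∀ S, 0 ≤ hb S) (hbh : ∀ S, hb S ≤ h S)
    (ka0 : ∀ S, 0 ≤ ka S) (kak : ∀ S, ka S ≤ k S) (kb0 : ∀ S, 0 ≤ kb S) (kbk : ∀ S, kb S ≤ k S) :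
    0 ≤ (∑ ω ∈ (E).powerset, if 𝒱 ω ∧ (b ∈ (openCluster (ends '' (↑(ω) : Set ι)) u) ∧ b ∉ (openCluster (ends '' (↑(E \ ω) : Set ι)) u)) then
        h (openCluster (ends '' (↑(ω) : Set ι)) u) * k (openCluster (ends '' (↑(ω) : Set ι)) u) else 0)
      + ∑ ω ∈ (E).powerset, if 𝒱 ω ∧ (b ∈ (openCluster (ends '' (↑(E \ ω) : Set ι)) u) ∧ b ∉ (openCluster (ends '' (↑(ω) : Set ι)) u)) then
        (ha (openCluster (ends '' (↑(ω) : Set ι)) u) - hb (openCluster (ends '' (↑(E \ ω) : Set ι)) u)) *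
          (ka (openCluster (ends '' (↑(ω) : Set ι)) u) - kb (openCluster (ends '' (↑(E \ ω) : Set ι)) u)) else 0 := by
  obtain ⟨hne12, he1E, he2E, hEeq⟩ := DigonSlices.digon_edges ends r L w e u b hw0 hwL harc hwinj A hA hAdisj E E' hEA hEA' hdig
  have he1' : e r 1 ∉ insert (e r 2) E' := by
    rw [Finset.mem_insert, not_or]; exact ⟨hne12, he1E⟩
  have decomp : (∑ ω ∈ E.powerset, ((if 𝒱 (ω) ∧ (b ∈ (openCluster (ends '' (↑(ω) : Set ι)) u) ∧ b ∉ (openCluster (ends '' (↑(E \ ω) : Set ι)) u)) then h (openCluster (ends '' (↑(ω) : Set ι)) u) * k (openCluster (ends '' (↑(ω) : Set ι)) u) else 0) +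
          (if 𝒱 (ω) ∧ (b ∈ (openCluster (ends '' (↑(E \ ω) : Set ι)) u) ∧ b ∉ (openCluster (ends '' (↑(ω) : Set ι)) u)) then (ha (openCluster (ends '' (↑(ω) : Set ι)) u) - hb (openCluster (ends '' (↑(E \ ω) : Set ι)) u)) * (ka (openCluster (ends '' (↑(ω) : Set ι)) u) - kb (openCluster (ends '' (↑(E \ ω) : Set ι)) u)) else 0))) =
      ((∑ ω ∈ E'.powerset, ((if 𝒱 (ω) ∧ (b ∈ (openCluster (ends '' (↑(ω) : Set ι)) u) ∧ b ∉ (openCluster (ends '' (↑(E \ ω) : Set ι)) u)) then h (openCluster (ends '' (↑(ω) : Set ι)) u) * k (openCluster (ends '' (↑(ω) : Set ι)) u) else 0) +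
          (if 𝒱 (ω) ∧ (b ∈ (openCluster (ends '' (↑(E \ ω) : Set ι)) u) ∧ b ∉ (openCluster (ends '' (↑(ω) : Set ι)) u)) then (ha (openCluster (ends '' (↑(ω) : Set ι)) u) - hb (openCluster (ends '' (↑(E \ ω) : Set ι)) u)) * (ka (openCluster (ends '' (↑(ω) : Set ι)) u) - kb (openCluster (ends '' (↑(E \ ω) : Set ι)) u)) else 0))) + ∑ ω ∈ E'.powerset, ((if 𝒱 (insert (e r 2) ω) ∧ (b ∈ (openCluster (ends '' (↑(insert (e r 2) ω) : Set ι)) u) ∧ b ∉ (openCluster (ends '' (↑(E \ insert (e r 2) ω) : Set ι)) u)) then h (openCluster (ends '' (↑(insert (e r 2) ω) : Set ι)) u) * k (openCluster (ends '' (↑(insert (e r 2) ω) : Set ι)) u) else 0) +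
          (if 𝒱 (insert (e r 2) ω) ∧ (b ∈ (openCluster (ends '' (↑(E \ insert (e r 2) ω) : Set ι)) u) ∧ b ∉ (openCluster (ends '' (↑(insert (e r 2) ω) : Set ι)) u)) then (ha (openCluster (ends '' (↑(insert (e r 2) ω) : Set ι)) u) - hb (openCluster (ends '' (↑(E \ insert (e r 2) ω) : Set ι)) u)) * (ka (openCluster (ends '' (↑(insert (e r 2) ω) : Set ι)) u) - kb (openCluster (ends '' (↑(E \ insert (e r 2) ω) : Set ι)) u)) else 0))) +
        ((∑ ω ∈ E'.powerset, ((if 𝒱 (insert (e r 1) ω) ∧ (b ∈ (openCluster (ends '' (↑(insert (e r 1) ω) : Set ι)) u) ∧ b ∉ (openCluster (ends '' (↑(E \ insert (e r 1) ω) : Set ι)) u)) then h (openCluster (ends '' (↑(insert (e r 1) ω) : Set ι)) u) * k (openCluster (ends '' (↑(insert (e r 1) ω) : Set ι)) u) else 0) +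
          (if 𝒱 (insert (e r 1) ω) ∧ (b ∈ (openCluster (ends '' (↑(E \ insert (e r 1) ω) : Set ι)) u) ∧ b ∉ (openCluster (ends '' (↑(insert (e r 1) ω) : Set ι)) u)) then (ha (openCluster (ends '' (↑(insert (e r 1) ω) : Set ι)) u) - hb (openCluster (ends '' (↑(E \ insert (e r 1) ω) : Set ι)) u)) * (ka (openCluster (ends '' (↑(insert (e r 1) ω) : Set ι)) u) - kb (openCluster (ends '' (↑(E \ insert (e r 1) ω) : Set ι)) u)) else 0))) + ∑ ω ∈ E'.powerset, ((if 𝒱 (insert (e r 1) (insert (e r 2) ω)) ∧ (b ∈ (openCluster (ends '' (↑(insert (e r 1) (insert (e r 2) ω)) : Set ι)) u) ∧ b ∉ (openCluster (ends '' (↑(E \ insert (e r 1) (insert (e r 2) ω)) : Set ι)) u)) then h (openCluster (ends '' (↑(insert (e r 1) (insert (e r 2) ω)) : Set ι)) u) * k (openCluster (ends '' (↑(insert (e r 1) (insert (e r 2) ω)) : Set ι)) u) else 0) +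
          (if 𝒱 (insert (e r 1) (insert (e r 2) ω)) ∧ (b ∈ (openCluster (ends '' (↑(E \ insert (e r 1) (insert (e r 2) ω)) : Set ι)) u) ∧ b ∉ (openCluster (ends '' (↑(insert (e r 1) (insert (e r 2) ω)) : Set ι)) u)) then (ha (openCluster (ends '' (↑(insert (e r 1) (insert (e r 2) ω)) : Set ι)) u) - hb (openCluster (ends '' (↑(E \ insert (e r 1) (insert (e r 2) ω)) : Set ι)) u)) * (ka (openCluster (ends '' (↑(insert (e r 1) (insert (e r 2) ω)) : Set ι)) u) - kb (openCluster (ends '' (↑(E \ insert (e r 1) (insert (e r 2) ω)) : Set ι)) u)) else 0))) := by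
    rw [show E.powerset = (insert (e r 1) (insert (e r 2) E')).powerset from by rw [← hEeq],
      Finset.sum_powerset_insert he1', Finset.sum_powerset_insert he2E, Finset.sum_powerset_insert he2E]
  have hRB := digon_slice_RB ends r L w e u b hw0 hwL harc hwinj hcross A hA hAdisj E E' hEA hEA' hdig hIH 𝒱 hV h k ha hb ka kb
    mh mk mha mhb mka mkb ha0 hah hb0 hbh ka0 kak kb0 kbk
  have hBR := digon_slice_BR ends r L w e u b hw0 hwL harc hwinj hcross A hA hAdisj E E' hEA hEA' hdig hIH 𝒱 hV h k ha hb ka kb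
    mh mk mha mhb mka mkb ha0 hah hb0 hbh ka0 kak kb0 kbk
  have hRRBB := digon_slice_RRBB ends r L hL w e u b hw0 hwL harc hwinj hcross A hA hAdisj E E' hEA hEA' hdig ec hec hecE 𝒱 hV h k ha hb ka kb
    mh mk mha mhb mka mkb ha0 hah hb0 hbh ka0 kak kb0 kbk
  rw [← Finset.sum_add_distrib, decomp]
  linarith [hRB, hBR, hRRBB]

end Coefficientwise

end Summit.CriticalPhenomena.PercolationContinuityZ3.Theorems
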